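import Mathlib.Analysis.Calculus.Deriv.MeanValue
import Mathlib.Analysis.Calculus.LocalExtr.Rolle
import Mathlib.Analysis.Calculus.ContDiff.Deriv
import Mathlib.Analysis.Calculus.ContDiff.Operations
import HarnessLib

/-!
# The mean value theorem for second divided differences and boundary inequalities

Topic `Literature/Analysis/Calculus`. Two pieces of one-variable calculus used by W. S. Ożański,
arXiv:1709.00602, Appendix 8.1 (the cut-off functions `f` with `Lf > 0` near `∂U` entering
Scheffer's construction, his Theorem 6; on the discharge path of the barrier fact
`Literature.Barriers.NavierStokesRegularity.NSIArrangementExists`):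

* **Lemma 19 (generalised mean value theorem)** — Conte–de Boor, *Elementary numerical
  analysis*, Thm. 4.2: for `a < b < c` and `f` continuous on `[a,c]`, twice differentiable on
  `(a,c)`, the second divided difference
  `f[a,b,c] = ((f(a)-f(b))/(a-b) - (f(c)-f(b))/(c-b))/(a-c)` equals `f''(ξ)/2` for some
  `ξ ∈ (a,c)` (the error `f - p` of the quadratic interpolant at `a, b, c` has three zeros, so
  by Rolle its second derivative `f'' - 2f[a,b,c]` vanishes somewhere) —
  `exists_secondDividedDiff_eq`;
* **Corollary 20** — if `f ∈ C³` vanishes on `(a-δ, a]` and `f''' > 0` on `(a, a+δ)`, then on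
  `(a, a+δ)`: `f'' > 0`, `0 < f' < (x-a) f''`, `f < (x-a)² f''` — `boundary_ineq_left`; and the
  mirror statement at a right endpoint (`g = 0` on `[b, b+δ)`, `g''' < 0` on `(b-δ, b)`):
  `g'' > 0`, `0 > g' > (x-b) g''`, `g < (x-b)² g''` on `(b-δ, b)` — `boundary_ineq_right`.

All statements are proved; derivatives are Mathlib's iterated `deriv`, and `f[a,b]` is Mathlib's
`slope f a b`.

## References

* W. S. Ożański, arXiv:1709.00602 (2017), Appendix 8.1, Lemma 19 and Corollary 20.
  [`Ozanski2017NSIInternal`]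
* S. D. Conte, C. de Boor, *Elementary numerical analysis*, Thm. 4.2 (cited there).
-/

noncomputable section

open Set Filter
open scoped Topology

namespace Literature.Analysis.Calculus

/-! ### Second divided differences -/

/-- The second divided difference `f[a,b,c] = (f[a,b] - f[c,b])/(a - c)` (Ożański 2017,
App. 8.1), where the first divided difference `f[a,b] = (f(a) - f(b))/(a - b)` is Mathlib's
`slope f a b` (`slope_def_field`). Junk value `0` when `a = c` (real division by zero); the
theorems below only use distinct points. [cite: Ozanski2017NSIInternal, Appendix 8.1 (before Lemma 19)] -/
def secondDividedDiff (f : ℝ → ℝ) (a b c : ℝ) : ℝ :=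
  (slope f a b - slope f c b) / (a - c)

/-- **Generalised mean value theorem** (Ożański 2017, Lemma 19; Conte–de Boor, Thm. 4.2). If
`a < b < c`, `f` is continuous on `[a,c]` and twice differentiable on `(a,c)`, then
`f[a,b,c] = f''(ξ)/2` for some `ξ ∈ (a,c)`. [cite: Ozanski2017NSIInternal, Lemma 19] -/
theorem exists_secondDividedDiff_eq {f : ℝ → ℝ} {a b c : ℝ} (hab : a < b) (hbc : b < c)
    (hf : ContinuousOn f (Icc a c)) (hf' : ∀ x ∈ Ioo a c, DifferentiableAt ℝ f x)
    (hf'' : ∀ x ∈ Ioo a c, DifferentiableAt ℝ (deriv f) x) :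
    ∃ ξ ∈ Ioo a c, secondDividedDiff f a b c = deriv (deriv f) ξ / 2 := by
  have hac : a < c := hab.trans hbc
  have hab' : a - b ≠ 0 := sub_ne_zero.2 hab.ne
  have hba' : b - a ≠ 0 := sub_ne_zero.2 hab.ne'
  have hcb' : c - b ≠ 0 := sub_ne_zero.2 hbc.ne'
  have hbc' : b - c ≠ 0 := sub_ne_zero.2 hbc.ne
  have hac' : a - c ≠ 0 := sub_ne_zero.2 hac.ne
  set D : ℝ := secondDividedDiff f a b c with hD
  set m : ℝ := slope f c b with hm
  -- the quadratic interpolant `p` and the error `e = f - p`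
  set p : ℝ → ℝ := fun x => D * ((x - b) * (x - c)) + m * (x - c) + f c with hp
  set e : ℝ → ℝ := fun x => f x - p x with he
  have hpd : ∀ x, HasDerivAt p (D * (2 * x - b - c) + m) x := fun x => by
    have h1 : HasDerivAt (fun y : ℝ => (y - b) * (y - c)) ((1 : ℝ) * (x - c) + (x - b) * 1) x :=
      ((hasDerivAt_id' x).sub_const b).mul ((hasDerivAt_id' x).sub_const c)
    have h2 : HasDerivAt p (D * ((1 : ℝ) * (x - c) + (x - b) * 1) + m * 1) x :=
      ((h1.const_mul D).add (((hasDerivAt_id' x).sub_const c).const_mul m)).add_const (f c)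
    exact h2.congr_deriv (by ring)
  have hea : e a = 0 := by
    simp only [he, hp, hD, hm, secondDividedDiff, slope_def_field]
    field_simp
    ring
  have heb : e b = 0 := by
    simp only [he, hp, hm, slope_def_field]
    field_simp
    ring
  have hec : e c = 0 := by
    simp only [he, hp]
    ring
  have hpc : Continuous p := by
    simp only [hp]
    fun_prop
  have hecont : ∀ {u v : ℝ}, Icc u v ⊆ Icc a c → ContinuousOn e (Icc u v) := fun h =>
    (hf.mono h).sub hpc.continuousOn
  -- Rolle twice for `e`
  obtain ⟨ξ₁, hξ₁, hξ₁'⟩ := exists_deriv_eq_zero hab (hecont (Icc_subset_Icc le_rfl hbc.le))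
    (by rw [hea, heb])
  obtain ⟨ξ₂, hξ₂, hξ₂'⟩ := exists_deriv_eq_zero hbc (hecont (Icc_subset_Icc hab.le le_rfl))
    (by rw [heb, hec])
  -- the derivative of `e` on `(a,c)`
  set e₁ : ℝ → ℝ := fun x => deriv f x - (D * (2 * x - b - c) + m) with he₁
  have hde : ∀ x ∈ Ioo a c, deriv e x = e₁ x := fun x hx => by
    simp only [he, he₁]
    rw [deriv_fun_sub (hf' x hx) (hpd x).differentiableAt, (hpd x).deriv]
  have h1 : e₁ ξ₁ = 0 := by rw [← hde ξ₁ ⟨hξ₁.1, hξ₁.2.trans hbc⟩, hξ₁']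
  have h2 : e₁ ξ₂ = 0 := by rw [← hde ξ₂ ⟨hab.trans hξ₂.1, hξ₂.2⟩, hξ₂']
  have hξ₁₂ : ξ₁ < ξ₂ := hξ₁.2.trans hξ₂.1
  have hsub : Icc ξ₁ ξ₂ ⊆ Ioo a c := fun x hx => ⟨hξ₁.1.trans_le hx.1, hx.2.trans_lt hξ₂.2⟩
  have he₁cont : ContinuousOn e₁ (Icc ξ₁ ξ₂) := by
    refine ContinuousOn.sub (fun x hx => ?_) (by fun_prop)
    exact (hf'' x (hsub hx)).continuousAt.continuousWithinAt
  -- Rolle for `e₁`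
  obtain ⟨ξ, hξ, hξ'⟩ := exists_deriv_eq_zero hξ₁₂ he₁cont (by rw [h1, h2])
  have hξac : ξ ∈ Ioo a c := ⟨hξ₁.1.trans hξ.1, hξ.2.trans hξ₂.2⟩
  have hde₁ : deriv e₁ ξ = deriv (deriv f) ξ - 2 * D := by
    have hlin : HasDerivAt (fun x : ℝ => D * (2 * x - b - c) + m) (D * 2) ξ := by
      have h := ((((hasDerivAt_id' ξ).const_mul 2).sub_const b).sub_const c).const_mul D
        |>.add_const m
      exact h.congr_deriv (by ring)
    simp only [he₁]
    rw [deriv_fun_sub (hf'' ξ hξac) hlin.differentiableAt, hlin.deriv]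
    ring
  refine ⟨ξ, hξac, ?_⟩
  rw [hde₁] at hξ'
  linarith

/-! ### Boundary inequalities (Ożański 2017, Corollary 20) -/

/-- A `C²` function vanishing on `(a-δ, a]` has `f' = f'' = 0` on `(a-δ, a]` (on the open
interval because it is locally zero, at `a` by continuity of `f'`, `f''`). Auxiliary for
`boundary_ineq_left`. [folklore] -/
theorem deriv_eq_zero_of_eqOn_zero {f : ℝ → ℝ} {a δ : ℝ} (hδ : 0 < δ) (hf : ContDiff ℝ 2 f)
    (hzero : ∀ x ∈ Ioc (a - δ) a, f x = 0) :
    (∀ x ∈ Ioc (a - δ) a, deriv f x = 0) ∧ ∀ x ∈ Ioc (a - δ) a, deriv (deriv f) x = 0 := by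
  have hf1 : ContDiff ℝ 1 (deriv f) := hf.deriv'
  have hcont1 : Continuous (deriv f) := hf1.continuous
  have hcont2 : Continuous (deriv (deriv f)) := hf1.continuous_deriv le_rfl
  -- on the open interval the function is locally zero
  have hopen : ∀ x ∈ Ioo (a - δ) a, deriv f x = 0 := fun x hx => by
    have h : f =ᶠ[𝓝 x] fun _ => 0 :=
      (eventuallyEq_of_mem (Ioo_mem_nhds hx.1 hx.2) fun y hy => hzero y ⟨hy.1, hy.2.le⟩)
    rw [h.deriv_eq, deriv_const]
  have hopen2 : ∀ x ∈ Ioo (a - δ) a, deriv (deriv f) x = 0 := fun x hx => by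
    have h : deriv f =ᶠ[𝓝 x] fun _ => 0 :=
      eventuallyEq_of_mem (Ioo_mem_nhds hx.1 hx.2) fun y hy => hopen y hy
    rw [h.deriv_eq, deriv_const]
  -- extend to the endpoint `a` by continuity
  have hclos : closure (Ioo (a - δ) a) = Icc (a - δ) a := closure_Ioo (by linarith)
  have ha : a ∈ closure (Ioo (a - δ) a) := by rw [hclos]; exact ⟨by linarith, le_rfl⟩
  have key : ∀ {g : ℝ → ℝ}, Continuous g → (∀ x ∈ Ioo (a - δ) a, g x = 0) → g a = 0 :=
    fun {g} hg h0 => by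
    have hcl : IsClosed {x | g x = 0} := isClosed_eq hg continuous_const
    exact closure_minimal (fun x hx => h0 x hx) hcl ha
  refine ⟨fun x hx => ?_, fun x hx => ?_⟩
  · rcases hx.2.lt_or_eq with h | h
    · exact hopen x ⟨hx.1, h⟩
    · rw [h]; exact key hcont1 hopen
  · rcases hx.2.lt_or_eq with h | h
    · exact hopen2 x ⟨hx.1, h⟩
    · rw [h]; exact key hcont2 hopen2

/-- **Boundary inequalities at a left endpoint** (Ożański 2017, Corollary 20). If `f ∈ C³`,
`f = 0` on `(a-δ, a]` and `f''' > 0` on `(a, a+δ)`, then for `x ∈ (a, a+δ)`: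
`f''(x) > 0`, `0 < f'(x) < (x-a) f''(x)` and `f(x) < (x-a)² f''(x)` (the first two by the mean
value theorem, `f''` being positive and increasing; the last by the generalised mean value theorem
at the points `2a-x, a, x`, where `f(x) = 2(x-a)² f[2a-x,a,x] = (x-a)² f''(ξ)`).
[cite: Ozanski2017NSIInternal, Corollary 20] -/
theorem boundary_ineq_left {f : ℝ → ℝ} {a δ : ℝ} (hδ : 0 < δ) (hf : ContDiff ℝ 3 f)
    (hzero : ∀ x ∈ Ioc (a - δ) a, f x = 0)
    (hpos : ∀ x ∈ Ioo a (a + δ), 0 < deriv (deriv (deriv f)) x) {x : ℝ} (hx : x ∈ Ioo a (a + δ)) :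
    0 < deriv (deriv f) x ∧ 0 < deriv f x ∧ deriv f x < (x - a) * deriv (deriv f) x ∧
      f x < (x - a) ^ 2 * deriv (deriv f) x := by
  have hf2 : ContDiff ℝ 2 f := hf.of_le (by norm_num)
  have hd1 : ContDiff ℝ 2 (deriv f) := hf.deriv'
  have hd2 : ContDiff ℝ 1 (deriv (deriv f)) := hd1.deriv'
  have hdiff0 : Differentiable ℝ f := hf.differentiable (by norm_num)
  have hdiff1 : Differentiable ℝ (deriv f) := hd1.differentiable (by norm_num)
  have hdiff2 : Differentiable ℝ (deriv (deriv f)) := hd2.differentiable (by norm_num)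
  obtain ⟨hz1, hz2⟩ := deriv_eq_zero_of_eqOn_zero hδ hf2 hzero
  have ha0 : f a = 0 := hzero a ⟨by linarith, le_rfl⟩
  have ha1 : deriv f a = 0 := hz1 a ⟨by linarith, le_rfl⟩
  have ha2 : deriv (deriv f) a = 0 := hz2 a ⟨by linarith, le_rfl⟩
  -- `f''` is strictly increasing on `[a, a+δ)`
  have hmono : StrictMonoOn (deriv (deriv f)) (Ico a (a + δ)) := by
    refine strictMonoOn_of_deriv_pos (convex_Ico _ _) hdiff2.continuous.continuousOn ?_
    rw [interior_Ico]
    exact hpos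
  have hxa : 0 < x - a := sub_pos.2 hx.1
  -- (1) `f''(x) > 0`
  have h1 : 0 < deriv (deriv f) x := by
    have := hmono ⟨le_rfl, by linarith⟩ ⟨hx.1.le, hx.2⟩ hx.1
    rwa [ha2] at this
  -- (2) `0 < f'(x) < (x-a) f''(x)` by the mean value theorem for `f'` on `[a, x]`
  have hf'pos : ∀ y ∈ Ioo a (a + δ), 0 < deriv f y ∧ deriv f y < (y - a) * deriv (deriv f) y := by
    intro y hy
    obtain ⟨η, hη, hη'⟩ := exists_deriv_eq_slope (deriv f) hy.1
      hdiff1.continuous.continuousOn (hdiff1.differentiableOn)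
    rw [ha1, sub_zero, eq_div_iff (sub_ne_zero.2 hy.1.ne')] at hη'
    have hηpos : 0 < deriv (deriv f) η := by
      have := hmono ⟨le_rfl, by linarith⟩ ⟨hη.1.le, hη.2.trans hy.2⟩ hη.1
      rwa [ha2] at this
    have hηlt : deriv (deriv f) η < deriv (deriv f) y :=
      hmono ⟨hη.1.le, hη.2.trans hy.2⟩ ⟨hy.1.le, hy.2⟩ hη.2
    have hya : 0 < y - a := sub_pos.2 hy.1
    constructor
    · rw [← hη']; positivity
    · rw [← hη', mul_comm]
      exact mul_lt_mul_of_pos_left hηlt hya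
  obtain ⟨h2, h3⟩ := hf'pos x hx
  -- `f(x) > 0` (mean value theorem for `f` on `[a, x]`)
  have hfxpos : 0 < f x := by
    obtain ⟨η, hη, hη'⟩ := exists_deriv_eq_slope f hx.1 hdiff0.continuous.continuousOn
      hdiff0.differentiableOn
    rw [ha0, sub_zero, eq_div_iff (sub_ne_zero.2 hx.1.ne')] at hη'
    rw [← hη']
    exact mul_pos (hf'pos η ⟨hη.1, hη.2.trans hx.2⟩).1 hxa
  -- (3) `f(x) < (x-a)² f''(x)` by the generalised mean value theorem at `2a - x < a < x`
  have h4 : f x < (x - a) ^ 2 * deriv (deriv f) x := by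
    have hlt1 : 2 * a - x < a := by linarith
    obtain ⟨ξ, hξ, hξ'⟩ := exists_secondDividedDiff_eq (f := f) hlt1 hx.1
      hdiff0.continuous.continuousOn (fun y _ => hdiff0 y) (fun y _ => hdiff1 y)
    have h2ax : f (2 * a - x) = 0 := hzero _ ⟨by linarith [hx.2], hlt1.le⟩
    have hval : secondDividedDiff f (2 * a - x) a x = f x / (2 * (x - a) ^ 2) := by
      have hs1 : slope f (2 * a - x) a = 0 := by
        rw [slope_def_field, ha0, h2ax, sub_zero, zero_div]
      have hs2 : slope f x a = -f x / (a - x) := by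
        rw [slope_def_field, ha0, zero_sub]
      have key : f x / ((a - x) * (2 * a - x - x)) = f x / (2 * (x - a) ^ 2) := by
        congr 1
        ring
      rw [secondDividedDiff, hs1, hs2]
      simp only [zero_sub, neg_div, neg_neg, div_div]
      exact key
    rw [hval, div_eq_div_iff (by positivity) two_ne_zero] at hξ'
    have hfx : f x = (x - a) ^ 2 * deriv (deriv f) ξ := by linarith
    -- `ξ > a`, for otherwise `f''(ξ) = 0` and `f(x) = 0`
    have hξa : a < ξ := by
      by_contra hle
      push Not at hle
      have : deriv (deriv f) ξ = 0 := hz2 ξ ⟨by linarith [hξ.1, hx.2], hle⟩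
      rw [this, mul_zero] at hfx
      linarith
    have hξlt : deriv (deriv f) ξ < deriv (deriv f) x :=
      hmono ⟨hξa.le, hξ.2.trans hx.2⟩ ⟨hx.1.le, hx.2⟩ hξ.2
    rw [hfx]
    exact mul_lt_mul_of_pos_left hξlt (by positivity)
  exact ⟨h1, h2, h3, h4⟩

/-- **Boundary inequalities at a right endpoint** (Ożański 2017, Corollary 20, second part). If
`g ∈ C³`, `g = 0` on `[b, b+δ)` and `g''' < 0` on `(b-δ, b)`, then for `x ∈ (b-δ, b)`:
`g''(x) > 0`, `0 > g'(x) > (x-b) g''(x)` and `g(x) < (x-b)² g''(x)` (apply the left-endpoint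
statement to `f(x) = g(2b - x)`). [cite: Ozanski2017NSIInternal, Corollary 20] -/
theorem boundary_ineq_right {g : ℝ → ℝ} {b δ : ℝ} (hδ : 0 < δ) (hg : ContDiff ℝ 3 g)
    (hzero : ∀ x ∈ Ico b (b + δ), g x = 0)
    (hneg : ∀ x ∈ Ioo (b - δ) b, deriv (deriv (deriv g)) x < 0) {x : ℝ} (hx : x ∈ Ioo (b - δ) b) :
    0 < deriv (deriv g) x ∧ deriv g x < 0 ∧ (x - b) * deriv (deriv g) x < deriv g x ∧
      g x < (x - b) ^ 2 * deriv (deriv g) x := by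
  -- the reflected function `f(y) = g(2b - y)`
  set f : ℝ → ℝ := fun y => g (2 * b - y) with hf_def
  have hr : ∀ y, HasDerivAt (fun y : ℝ => 2 * b - y) (-1) y := fun y => by
    simpa using (hasDerivAt_id y).const_sub (2 * b)
  have hrefl : ContDiff ℝ 3 (fun y : ℝ => 2 * b - y) := contDiff_const.sub contDiff_id
  have hf : ContDiff ℝ 3 f := hg.comp hrefl
  have hg1 : Differentiable ℝ g := hg.differentiable (by norm_num)
  have hg2 : Differentiable ℝ (deriv g) := (hg.deriv' (n := 2)).differentiable (by norm_num)
  have hg3 : Differentiable ℝ (deriv (deriv g)) :=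
    ((hg.deriv' (n := 2)).deriv' (n := 1)).differentiable (by norm_num)
  -- derivatives of the reflected function
  have hd1 : ∀ y, deriv f y = -deriv g (2 * b - y) := fun y => by
    have h : HasDerivAt (fun y => g (2 * b - y)) (deriv g (2 * b - y) * -1) y :=
      (hg1 (2 * b - y)).hasDerivAt.comp y (hr y)
    rw [hf_def, h.deriv]; ring
  have hd1' : deriv f = fun y => -deriv g (2 * b - y) := funext hd1
  have hd2 : ∀ y, deriv (deriv f) y = deriv (deriv g) (2 * b - y) := fun y => by
    rw [hd1']
    have h : HasDerivAt (fun y => -deriv g (2 * b - y)) (-(deriv (deriv g) (2 * b - y) * -1)) y :=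
      ((hg2 (2 * b - y)).hasDerivAt.comp y (hr y)).neg
    rw [h.deriv]; ring
  have hd2' : deriv (deriv f) = fun y => deriv (deriv g) (2 * b - y) := funext hd2
  have hd3 : ∀ y, deriv (deriv (deriv f)) y = -deriv (deriv (deriv g)) (2 * b - y) := fun y => by
    rw [hd2']
    have h : HasDerivAt (fun y => deriv (deriv g) (2 * b - y))
        (deriv (deriv (deriv g)) (2 * b - y) * -1) y :=
      (hg3 (2 * b - y)).hasDerivAt.comp y (hr y)
    rw [h.deriv]; ring
  -- hypotheses of the left-endpoint statement at `a = b` for `f`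
  have hzero' : ∀ y ∈ Ioc (b - δ) b, f y = 0 := fun y hy =>
    hzero (2 * b - y) ⟨by linarith [hy.2], by linarith [hy.1]⟩
  have hpos' : ∀ y ∈ Ioo b (b + δ), 0 < deriv (deriv (deriv f)) y := fun y hy => by
    rw [hd3]
    have := hneg (2 * b - y) ⟨by linarith [hy.2], by linarith [hy.1]⟩
    linarith
  have hx' : 2 * b - x ∈ Ioo b (b + δ) := ⟨by linarith [hx.2], by linarith [hx.1]⟩
  obtain ⟨h1, h2, h3, h4⟩ := boundary_ineq_left hδ hf hzero' hpos' hx'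
  rw [hd2] at h1 h3 h4
  rw [hd1] at h2 h3
  have e : 2 * b - (2 * b - x) = x := by ring
  rw [e] at h1 h2 h3 h4
  simp only [hf_def, e] at h4
  refine ⟨h1, by linarith, ?_, ?_⟩
  · have : (2 * b - x - b) * deriv (deriv g) x = -((x - b) * deriv (deriv g) x) := by ring
    rw [this] at h3
    linarith
  · have : (2 * b - x - b) ^ 2 = (x - b) ^ 2 := by ring
    rwa [this] at h4

end Literature.Analysis.Calculus
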